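import Mathlib
import Literature.Analysis.ODE.VariationalEnclosure
import Literature.Analysis.ODE.HighOrderEnclosureOpenDomain
import HarnessLib

/-!
# The C¹ high-order enclosure for a field defined on an open domain

`Literature.Analysis.ODE.variationalEnclosure_step` (`VariationalEnclosure.lean`; Walawska–Wilczak
2016 §2.1, Zgliczyński 2002) proves the `C¹` version of Lohner's high-order enclosure (HOE) step
for the variational system `y' = f(y)`, `V' = Df(y) V`, `y(0) = x`, `V(0) = Id` in two halves: an
enclosed solution pair EXISTS (`exists_solution_of_variationalEnclosure`, no growth hypothesis),
and EVERY solution pair from `(x, Id)` is so enclosed (`solution_mem_of_variationalEnclosure`,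
`variationalEnclosure_step`, `hasFDerivWithinAt_flow_of_variationalEnclosure`), the latter under
the hypothesis `hloc` that `f` is Lipschitz on every bounded subset of the whole space.  The
published statement (Walawska–Wilczak 2016, §1.1: "`f : ℝⁿ → ℝⁿ` is a smooth function (usually
analytic in the domain)") concerns fields smooth on their DOMAIN; for the quotient / logarithm /
root / real-power fields of interval Taylor-series integrators (Moore 1979 §3.4 (3.19)) the field
is smooth only on an open `Ω` and `hloc` is not available (in Lean the field is a total function
with arbitrary values off `Ω`).

Exactly as for the `C⁰` step (`HighOrderEnclosureOpenDomain.lean`), `hloc` is used only through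
uniqueness of the state component along the ONE enclosed solution, which stays in the a-priori box
`S ⊆ Ω`; so it is replaced by a Lipschitz condition on some neighbourhood of each point of `S`
(Teschl 2012 §2.6: uniqueness on the common interval by continuation of local uniqueness —
`ODE_solution_unique_of_lipschitzOnWith_nhds`), the matrix component being unique by Grönwall for
the linear equation `J' = Df(y(t)) ∘ J`:

* `solution_mem_of_variationalEnclosure_local`, `variationalEnclosure_step_local`,
  `hasFDerivWithinAt_flow_of_variationalEnclosure_local` — the three uniqueness-side theorems of
  `VariationalEnclosure.lean` VERBATIM except `hloc` ↦ `hfl : ∀ x ∈ S, ∃ K U, U ∈ 𝓝 x ∧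
  LipschitzOnWith K f U`;
* for a field `f ∈ C^∞(Ω; ℝ^ι)` on an open `Ω` (the setting of `SmoothFieldTaylorCoefficients.lean`:
  `Φ_j = smoothTaylorMap hf j = (1/j!) L_f^j Id`, Jacobians `Φ_j' = smoothTaylorFDeriv hf j`):
  `contDiffOn_smoothTaylorMap`, `fderiv_smoothTaylorMap_of_mem`, `contDiffOn_fderiv_smoothTaylorMap`,
  `hasFDerivAt_fderiv_smoothTaylorMap`, `fderiv_smoothTaylorMap_zero`,
  `fderiv_smoothTaylorMap_apply_field`, `exists_bound_fderiv_smoothTaylorMap`,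
  `exists_lipschitzOnWith_fderiv_smoothTaylorMap` — the SECOND-ORDER analytic data of the `C¹`
  test (`Φ_j''`, its bound on a compact `S ⊆ Ω`, the Lipschitz constant of `Φ_K'` on a compact
  convex `S`), i.e. the hypotheses `hΦ'0`, `hder`, `hder2`, `hf'`, `hrec`, `hbd`, `hbd2`, `hlipK`,
  `hlipK'` of `variationalEnclosure_step` discharged;
* `variationalEnclosure_step_smoothOn_local`, `hasFDerivWithinAt_flow_of_variationalEnclosure_smoothOn_local`
  — the `C¹` HOE step for `f ∈ C^∞(Ω)`, `S ⊆ Ω` compact convex: ONLY the set-level checks remain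
  (`Φ_K(S) ⊆ [c, d]`, `Φ_K'(S) 𝒱 ⊆ [CN, DN]`, the two inclusion tests), and the conclusion is the
  enclosure of every solution pair from `(x, Id)`, `x ∈ W`, and of the derivative of the flow
  `∂φ(τ, x)/∂x ∈ ∑_{j<K} τ^j Φ_j'(x) + τ^K [CN, DN] ⊆ [CV, DV]` — with no hypothesis on `f` off `Ω`.

## References

* I. Walawska, D. Wilczak, *An implicit algorithm for validated enclosures of the solutions to
  variational equations for ODEs*, Appl. Math. Comput. 291 (2016) 303–322 (arXiv:1509.07388),
  §1.1 (the setting: `f` smooth in the domain, `ψ(t,x,V) = D_xφ(t,x)·V`), §2.1 (the `C¹`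
  high-order enclosure `[0,h]^{m+1} ψ^[m+1](0,[ỹ],Id)·[Ṽ] ⊂ [E]`), §2.2 Lemma 2.
  [WalawskaWilczak2016]
* P. Zgliczyński, *C¹ Lohner algorithm*, Found. Comput. Math. 2 (2002) 429–465.
  [Zgliczynski2002C1Lohner]
* G. Teschl, *Ordinary Differential Equations and Dynamical Systems*, AMS GSM 140 (2012), §2.2
  Problem 2.5 (C¹ ⇒ locally Lipschitz), §2.6 (uniqueness on the common interval, the paragraph
  before Theorem 2.13). [Teschl2012]
* E. Hairer, C. Lubich, G. Wanner, *Geometric Numerical Integration* (2002), §III.5.1 eqs.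
  (5.3)–(5.8) (Lie derivative, `Φ_j = (1/j!) L_f^j Id`). [HairerWannerLubich2002]
* R. E. Moore, *Methods and Applications of Interval Analysis*, SIAM 1979, §3.4 (3.13)–(3.19).
  [Moore1979]
-/

noncomputable section

open Set Metric Filter Topology TopologicalSpace

open scoped NNReal ContDiff

namespace Literature.Analysis.ODE

/-! ### Grönwall uniqueness for the linear matrix equation -/

section Linear

variable {E : Type*} [NormedAddCommGroup E] [NormedSpace ℝ E]

/-- Uniqueness of solutions of the linear equation `J' = A(t) ∘ J` on `[0, h]` with bounded
coefficients (Grönwall, via `norm_sub_le_of_linear` of `FlowWithin.lean`). [folklore] -/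
private theorem eqOn_Icc_of_linear_of_norm_le {A : ℝ → E →L[ℝ] E} {h M : ℝ}
    {J₁ J₂ : ℝ → E →L[ℝ] E}
    (hJ₁ : ∀ t ∈ Icc 0 h, HasDerivWithinAt J₁ ((A t).comp (J₁ t)) (Icc 0 h) t)
    (hJ₂ : ∀ t ∈ Icc 0 h, HasDerivWithinAt J₂ ((A t).comp (J₂ t)) (Icc 0 h) t)
    (hM : ∀ t ∈ Ico 0 h, ‖A t‖ ≤ M) (h0 : J₁ 0 = J₂ 0) : EqOn J₁ J₂ (Icc 0 h) := by
  intro t ht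
  have hc : ContinuousOn J₂ (Icc 0 h) := fun s hs => (hJ₂ s hs).continuousWithinAt
  obtain ⟨P, hP⟩ := isCompact_Icc.exists_bound_of_continuousOn hc
  have key := norm_sub_le_of_linear hJ₁ hJ₂ hM (fun s _ => by simp) (fun s hs =>
    hP s (Ico_subset_Icc_self hs)) le_rfl t ht
  rw [h0, sub_self, norm_zero, zero_mul, gronwallBound_ε0_δ0] at key
  exact sub_eq_zero.1 (norm_le_zero_iff.1 key)

end Linear

/-! ### The C¹ step with a local Lipschitz hypothesis on the a-priori box only -/

section Local

variable {ι : Type*} [Fintype ι] [DecidableEq ι]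

omit [Fintype ι] [DecidableEq ι] in
/-- At `t = 0` the Taylor enclosure `∑_{j<K} t^j • Φ j x + t^K • v` (`K ≥ 1`, `Φ 0 = id`) is the
point `x` itself; in particular the initial point lies in the a-priori box. [folklore] -/
private theorem taylorSum_at_zero {Φ : ℕ → (ι → ℝ) → ι → ℝ} (hΦ0 : ∀ x, Φ 0 x = x) {K : ℕ}
    (hK : 0 < K) (x v : ι → ℝ) :
    (∑ j ∈ Finset.range K, (0 : ℝ) ^ j • Φ j x) + (0 : ℝ) ^ K • v = x := by
  rw [zero_pow hK.ne', zero_smul, add_zero, Finset.sum_eq_single 0, pow_zero, one_smul, hΦ0]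
  · intro j _ hj
    rw [zero_pow hj, zero_smul]
  · intro h0
    exact absurd (Finset.mem_range.2 hK) h0

/-- **Every solution of the variational system is enclosed — local form** (Walawska–Wilczak 2016
§2.1, Zgliczyński 2002; uniqueness along the enclosed solution: Teschl 2012 §2.6).  Under the
hypotheses of `exists_solution_of_variationalEnclosure`, if `f` is Lipschitz on some neighbourhood
of every point of the a-priori box `S` (e.g. `f ∈ C¹(Ω)`, `Ω ⊇ S` open), then EVERY pair `(z, J)`
solving `z' = f(z)`, `J' = f'(z) ∘ J` on `[0, h]` with `z 0 = x`, `J 0 = Id` satisfies `z t ∈ S`,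
`z t ∈ ∑_{j<K} t^j Φ j x + t^K [c, d]`, `J t ∈ [CV, DV]` and `J t ∈ ∑_{j<K} t^j Φ' j x + t^K [CN, DN]`
(entrywise) for all `t ∈ [0, h]` — `solution_mem_of_variationalEnclosure` with its growth
hypothesis `hloc` (Lipschitz on all bounded sets) replaced by the local condition `hfl` on `S`.
[cite: WalawskaWilczak2016, §2.1 (C¹ high-order enclosure) and §2.2 Lemma 2]
[cite: Teschl2012, §2.6 (uniqueness on the common interval, before Theorem 2.13)] -/
theorem solution_mem_of_variationalEnclosure_local {f : (ι → ℝ) → ι → ℝ}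
    {f' : (ι → ℝ) → ((ι → ℝ) →L[ℝ] (ι → ℝ))}
    {Φ : ℕ → (ι → ℝ) → ι → ℝ} {Φ' : ℕ → (ι → ℝ) → ((ι → ℝ) →L[ℝ] (ι → ℝ))}
    {Φ'' : ℕ → (ι → ℝ) → ((ι → ℝ) →L[ℝ] (ι → ℝ) →L[ℝ] (ι → ℝ))} {Ω S : Set (ι → ℝ)}
    {K : ℕ} (hK : 0 < K) {L L' : ℝ≥0} {B : ℝ} {c d x : ι → ℝ} {CV DV CN DN : ι → ι → ℝ} {h : ℝ}
    (hΩ : IsOpen Ω) (hSΩ : S ⊆ Ω)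
    (hΦ0 : ∀ x, Φ 0 x = x) (hΦ'0 : ∀ x, Φ' 0 x = 1)
    (hder : ∀ j ≤ K, ∀ x ∈ Ω, HasFDerivAt (Φ j) (Φ' j x) x)
    (hder2 : ∀ j < K, ∀ x ∈ Ω, HasFDerivAt (Φ' j) (Φ'' j x) x)
    (hf' : ∀ x ∈ Ω, HasFDerivAt f (f' x) x)
    (hrec : ∀ j < K, ∀ x ∈ Ω, Φ' j x (f x) = ((j : ℝ) + 1) • Φ (j + 1) x)
    (hbd : ∀ j ≤ K, ∀ x ∈ S, ‖Φ' j x‖ ≤ B) (hbd2 : ∀ j < K, ∀ x ∈ S, ‖Φ'' j x‖ ≤ B)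
    (hlipK : LipschitzOnWith L (Φ K) S) (hlipK' : LipschitzOnWith L' (Φ' K) S)
    (hcd : c ≤ d) (hKS : MapsTo (Φ K) S (Icc c d)) (hCDN : CN ≤ DN)
    (hKN : ∀ z ∈ S, ∀ M : (ι → ℝ) →L[ℝ] (ι → ℝ), (fun i j => M (Pi.single j 1) i) ∈ Icc CV DV →
      (fun i j => (Φ' K z).comp M (Pi.single j 1) i) ∈ Icc CN DN)
    (hh : 0 ≤ h)
    (hincl : ∀ t ∈ Icc 0 h, ∀ v ∈ Icc c d,
      (∑ j ∈ Finset.range K, t ^ j • Φ j x) + t ^ K • v ∈ S)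
    (hinclV : ∀ t ∈ Icc 0 h, ∀ N : (ι → ℝ) →L[ℝ] (ι → ℝ),
      (fun i j => N (Pi.single j 1) i) ∈ Icc CN DN →
      (fun i j => ((∑ k ∈ Finset.range K, t ^ k • Φ' k x) + t ^ K • N) (Pi.single j 1) i) ∈
        Icc CV DV)
    (hfl : ∀ x ∈ S, ∃ K' : ℝ≥0, ∃ U ∈ 𝓝 x, LipschitzOnWith K' f U)
    {z : ℝ → ι → ℝ} {J : ℝ → (ι → ℝ) →L[ℝ] (ι → ℝ)} (hz0 : z 0 = x) (hJ0 : J 0 = 1)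
    (hz : ∀ t ∈ Icc 0 h, HasDerivWithinAt z (f (z t)) (Icc 0 h) t)
    (hJ : ∀ t ∈ Icc 0 h, HasDerivWithinAt J ((f' (z t)).comp (J t)) (Icc 0 h) t)
    {t : ℝ} (ht : t ∈ Icc 0 h) :
    (z t ∈ S ∧ ∃ v ∈ Icc c d, z t = (∑ j ∈ Finset.range K, t ^ j • Φ j x) + t ^ K • v) ∧
      (fun i j => J t (Pi.single j 1) i) ∈ Icc CV DV ∧
      ∃ N : (ι → ℝ) →L[ℝ] (ι → ℝ), (fun i j => N (Pi.single j 1) i) ∈ Icc CN DN ∧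
        J t = (∑ j ∈ Finset.range K, t ^ j • Φ' j x) + t ^ K • N := by
  obtain ⟨y, V, hy0, hV0, hy, hV, henc⟩ := exists_solution_of_variationalEnclosure hK hΩ hSΩ hΦ0
    hΦ'0 hder hder2 hf' hrec hbd hbd2 hlipK hlipK' hcd hKS hCDN hKN hh hincl hinclV
  -- uniqueness of the state component along the enclosed solution `y`, which stays in `S`
  have hEq : EqOn y z (Icc 0 h) :=
    ODE_solution_unique_of_lipschitzOnWith_nhds (fun s hs => hfl (y s) (henc s hs).1.1) hy hz
      (hy0.trans hz0.symm)
  -- `f' = Φ' 1` on `Ω`, hence `‖f' (y s)‖ ≤ B`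
  have hfΦ : ∀ p ∈ Ω, f p = Φ 1 p := fun p hp => by
    have h1 := hrec 0 hK p hp
    simpa [hΦ'0] using h1
  have hA : ∀ s ∈ Ico 0 h, ‖f' (y s)‖ ≤ B := fun s hs => by
    have hyS : y s ∈ S := (henc s (Ico_subset_Icc_self hs)).1.1
    have h1 : HasFDerivAt f (Φ' 1 (y s)) (y s) :=
      (hder 1 (Nat.succ_le_of_lt hK) _ (hSΩ hyS)).congr_of_eventuallyEq
        ((hΩ.eventually_mem (hSΩ hyS)).mono fun p hp => hfΦ p hp)
    rw [(hf' _ (hSΩ hyS)).unique h1]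
    exact hbd 1 (Nat.succ_le_of_lt hK) _ hyS
  have hJ' : ∀ s ∈ Icc 0 h, HasDerivWithinAt J ((f' (y s)).comp (J s)) (Icc 0 h) s :=
    fun s hs => by rw [hEq hs]; exact hJ s hs
  have hVJ : V t = J t := eqOn_Icc_of_linear_of_norm_le hV hJ' hA (hV0.trans hJ0.symm) ht
  obtain ⟨hyenc, hVenc, N, hN, hVt⟩ := henc t ht
  rw [hEq ht] at hyenc
  rw [hVJ] at hVenc hVt
  exact ⟨hyenc, hVenc, N, hN, hVt⟩

/-- **The step form of the `C¹` high-order enclosure test — local form.** As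
`variationalEnclosure_step` (for every `x` in the box `W` of initial points the variational
system from `(x, Id)` has a solution on `[0, h]`, and every solution pair satisfies `z t ∈ S`,
`J t ∈ Ṽ = [CV, DV]` and the tight Taylor enclosures on `[0, h]`), with the growth hypothesis
`hloc` replaced by: `f` is Lipschitz on a neighbourhood of each point of `S`.
[cite: WalawskaWilczak2016, §2.1 (C¹ high-order enclosure) and §2.2 Lemma 2]
[cite: Teschl2012, §2.6 (uniqueness on the common interval, before Theorem 2.13)] -/
theorem variationalEnclosure_step_local {f : (ι → ℝ) → ι → ℝ}
    {f' : (ι → ℝ) → ((ι → ℝ) →L[ℝ] (ι → ℝ))}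
    {Φ : ℕ → (ι → ℝ) → ι → ℝ} {Φ' : ℕ → (ι → ℝ) → ((ι → ℝ) →L[ℝ] (ι → ℝ))}
    {Φ'' : ℕ → (ι → ℝ) → ((ι → ℝ) →L[ℝ] (ι → ℝ) →L[ℝ] (ι → ℝ))} {Ω S W : Set (ι → ℝ)}
    {K : ℕ} (hK : 0 < K) {L L' : ℝ≥0} {B : ℝ} {c d : ι → ℝ} {CV DV CN DN : ι → ι → ℝ} {h : ℝ}
    (hΩ : IsOpen Ω) (hSΩ : S ⊆ Ω)
    (hΦ0 : ∀ x, Φ 0 x = x) (hΦ'0 : ∀ x, Φ' 0 x = 1)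
    (hder : ∀ j ≤ K, ∀ x ∈ Ω, HasFDerivAt (Φ j) (Φ' j x) x)
    (hder2 : ∀ j < K, ∀ x ∈ Ω, HasFDerivAt (Φ' j) (Φ'' j x) x)
    (hf' : ∀ x ∈ Ω, HasFDerivAt f (f' x) x)
    (hrec : ∀ j < K, ∀ x ∈ Ω, Φ' j x (f x) = ((j : ℝ) + 1) • Φ (j + 1) x)
    (hbd : ∀ j ≤ K, ∀ x ∈ S, ‖Φ' j x‖ ≤ B) (hbd2 : ∀ j < K, ∀ x ∈ S, ‖Φ'' j x‖ ≤ B)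
    (hlipK : LipschitzOnWith L (Φ K) S) (hlipK' : LipschitzOnWith L' (Φ' K) S)
    (hcd : c ≤ d) (hKS : MapsTo (Φ K) S (Icc c d)) (hCDN : CN ≤ DN)
    (hKN : ∀ z ∈ S, ∀ M : (ι → ℝ) →L[ℝ] (ι → ℝ), (fun i j => M (Pi.single j 1) i) ∈ Icc CV DV →
      (fun i j => (Φ' K z).comp M (Pi.single j 1) i) ∈ Icc CN DN)
    (hh : 0 ≤ h) (hfl : ∀ x ∈ S, ∃ K' : ℝ≥0, ∃ U ∈ 𝓝 x, LipschitzOnWith K' f U)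
    (hincl : ∀ x ∈ W, ∀ t ∈ Icc 0 h, ∀ v ∈ Icc c d,
      (∑ j ∈ Finset.range K, t ^ j • Φ j x) + t ^ K • v ∈ S)
    (hinclV : ∀ x ∈ W, ∀ t ∈ Icc 0 h, ∀ N : (ι → ℝ) →L[ℝ] (ι → ℝ),
      (fun i j => N (Pi.single j 1) i) ∈ Icc CN DN →
      (fun i j => ((∑ k ∈ Finset.range K, t ^ k • Φ' k x) + t ^ K • N) (Pi.single j 1) i) ∈
        Icc CV DV)
    {x : ι → ℝ} (hx : x ∈ W) :
    (∃ y : ℝ → ι → ℝ, ∃ V : ℝ → (ι → ℝ) →L[ℝ] (ι → ℝ), y 0 = x ∧ V 0 = 1 ∧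
      (∀ t ∈ Icc 0 h, HasDerivWithinAt y (f (y t)) (Icc 0 h) t) ∧
      ∀ t ∈ Icc 0 h, HasDerivWithinAt V ((f' (y t)).comp (V t)) (Icc 0 h) t) ∧
    ∀ (z : ℝ → ι → ℝ) (J : ℝ → (ι → ℝ) →L[ℝ] (ι → ℝ)), z 0 = x → J 0 = 1 →
      (∀ t ∈ Icc 0 h, HasDerivWithinAt z (f (z t)) (Icc 0 h) t) →
      (∀ t ∈ Icc 0 h, HasDerivWithinAt J ((f' (z t)).comp (J t)) (Icc 0 h) t) →
      ∀ t ∈ Icc 0 h,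
        (z t ∈ S ∧ ∃ v ∈ Icc c d, z t = (∑ j ∈ Finset.range K, t ^ j • Φ j x) + t ^ K • v) ∧
        (fun i j => J t (Pi.single j 1) i) ∈ Icc CV DV ∧
        ∃ N : (ι → ℝ) →L[ℝ] (ι → ℝ), (fun i j => N (Pi.single j 1) i) ∈ Icc CN DN ∧
          J t = (∑ j ∈ Finset.range K, t ^ j • Φ' j x) + t ^ K • N := by
  refine ⟨?_, fun z J hz0 hJ0 hz hJ t ht => solution_mem_of_variationalEnclosure_local hK hΩ hSΩ
    hΦ0 hΦ'0 hder hder2 hf' hrec hbd hbd2 hlipK hlipK' hcd hKS hCDN hKN hh (hincl x hx)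
    (hinclV x hx) hfl hz0 hJ0 hz hJ ht⟩
  obtain ⟨y, V, hy0, hV0, hy, hV, -⟩ := exists_solution_of_variationalEnclosure hK hΩ hSΩ hΦ0
    hΦ'0 hder hder2 hf' hrec hbd hbd2 hlipK hlipK' hcd hKS hCDN hKN hh (hincl x hx) (hinclV x hx)
  exact ⟨y, V, hy0, hV0, hy, hV⟩

/-- **The variational enclosure bounds the derivative of the flow — local form** (Zgliczyński
2002; Walawska–Wilczak 2016, §1.1–§2: `V(t, x) = ∂φ/∂x (t, x)`).  As
`hasFDerivWithinAt_flow_of_variationalEnclosure` (for ANY family `u` of solutions of `y' = f(y)`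
on `[0, h]` from the points of `W` staying in the convex box `S` on which `f` is `C¹`, the flow map
`x' ↦ u x' τ` has a derivative `J` at `x ∈ W` within `W` with `J ∈ [CV, DV]`,
`J = ∑_{j<K} τ^j • Φ' j x + τ^K • N`, `N ∈ [CN, DN]`), with the growth hypothesis `hloc` replaced
by: `f` is Lipschitz on a neighbourhood of each point of `S`.
[cite: WalawskaWilczak2016, §1.1 (ψ = D_xφ·V) and §2.2 Lemma 2]
[cite: Teschl2012, §2.6 (uniqueness on the common interval, before Theorem 2.13)] -/
theorem hasFDerivWithinAt_flow_of_variationalEnclosure_local {f : (ι → ℝ) → ι → ℝ}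
    {f' : (ι → ℝ) → ((ι → ℝ) →L[ℝ] (ι → ℝ))}
    {Φ : ℕ → (ι → ℝ) → ι → ℝ} {Φ' : ℕ → (ι → ℝ) → ((ι → ℝ) →L[ℝ] (ι → ℝ))}
    {Φ'' : ℕ → (ι → ℝ) → ((ι → ℝ) →L[ℝ] (ι → ℝ) →L[ℝ] (ι → ℝ))} {Ω S W : Set (ι → ℝ)}
    {K : ℕ} (hK : 0 < K) {L L' : ℝ≥0} {B : ℝ} {c d : ι → ℝ} {CV DV CN DN : ι → ι → ℝ} {h : ℝ}
    (hΩ : IsOpen Ω) (hSΩ : S ⊆ Ω)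
    (hΦ0 : ∀ x, Φ 0 x = x) (hΦ'0 : ∀ x, Φ' 0 x = 1)
    (hder : ∀ j ≤ K, ∀ x ∈ Ω, HasFDerivAt (Φ j) (Φ' j x) x)
    (hder2 : ∀ j < K, ∀ x ∈ Ω, HasFDerivAt (Φ' j) (Φ'' j x) x)
    (hf' : ∀ x ∈ Ω, HasFDerivAt f (f' x) x)
    (hrec : ∀ j < K, ∀ x ∈ Ω, Φ' j x (f x) = ((j : ℝ) + 1) • Φ (j + 1) x)
    (hbd : ∀ j ≤ K, ∀ x ∈ S, ‖Φ' j x‖ ≤ B) (hbd2 : ∀ j < K, ∀ x ∈ S, ‖Φ'' j x‖ ≤ B)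
    (hlipK : LipschitzOnWith L (Φ K) S) (hlipK' : LipschitzOnWith L' (Φ' K) S)
    (hcd : c ≤ d) (hKS : MapsTo (Φ K) S (Icc c d)) (hCDN : CN ≤ DN)
    (hKN : ∀ z ∈ S, ∀ M : (ι → ℝ) →L[ℝ] (ι → ℝ), (fun i j => M (Pi.single j 1) i) ∈ Icc CV DV →
      (fun i j => (Φ' K z).comp M (Pi.single j 1) i) ∈ Icc CN DN)
    (hh : 0 ≤ h) (hfl : ∀ x ∈ S, ∃ K' : ℝ≥0, ∃ U ∈ 𝓝 x, LipschitzOnWith K' f U)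
    (hincl : ∀ x ∈ W, ∀ t ∈ Icc 0 h, ∀ v ∈ Icc c d,
      (∑ j ∈ Finset.range K, t ^ j • Φ j x) + t ^ K • v ∈ S)
    (hinclV : ∀ x ∈ W, ∀ t ∈ Icc 0 h, ∀ N : (ι → ℝ) →L[ℝ] (ι → ℝ),
      (fun i j => N (Pi.single j 1) i) ∈ Icc CN DN →
      (fun i j => ((∑ k ∈ Finset.range K, t ^ k • Φ' k x) + t ^ K • N) (Pi.single j 1) i) ∈
        Icc CV DV)
    (hSc : Convex ℝ S) (hSu : UniqueDiffOn ℝ S) (hfC : ContDiffOn ℝ 1 f S)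
    {u : (ι → ℝ) → ℝ → ι → ℝ} (hu : IsSolutionFamily f S W h u) {x : ι → ℝ} (hx : x ∈ W)
    {τ : ℝ} (hτ : τ ∈ Icc 0 h) :
    ∃ J : (ι → ℝ) →L[ℝ] (ι → ℝ), HasFDerivWithinAt (fun x' => u x' τ) J W x ∧
      (fun i j => J (Pi.single j 1) i) ∈ Icc CV DV ∧
      ∃ N : (ι → ℝ) →L[ℝ] (ι → ℝ), (fun i j => N (Pi.single j 1) i) ∈ Icc CN DN ∧
        J = (∑ j ∈ Finset.range K, τ ^ j • Φ' j x) + τ ^ K • N := by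
  obtain ⟨y, V, hy0, hV0, hy, hV, henc⟩ := exists_solution_of_variationalEnclosure hK hΩ hSΩ hΦ0
    hΦ'0 hder hder2 hf' hrec hbd hbd2 hlipK hlipK' hcd hKS hCDN hKN hh (hincl x hx) (hinclV x hx)
  have hEq : EqOn y (u x) (Icc 0 h) :=
    ODE_solution_unique_of_lipschitzOnWith_nhds (fun s hs => hfl (y s) (henc s hs).1.1) hy
      (hu.hasDerivWithinAt x hx) (hy0.trans (hu.init x hx).symm)
  have hVJ : ∀ t ∈ Icc 0 h,
      HasDerivWithinAt V ((fderivWithin ℝ f S (u x t)).comp (V t)) (Icc 0 h) t := by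
    intro t ht
    have huS : u x t ∈ S := hu.mem x hx t ht
    have hfd : fderivWithin ℝ f S (u x t) = f' (u x t) :=
      (hf' _ (hSΩ huS)).hasFDerivWithinAt.fderivWithin (hSu _ huS)
    rw [hfd, ← hEq ht]
    exact hV t ht
  obtain ⟨-, hVenc, N, hN, hVt⟩ := henc τ hτ
  exact ⟨V τ, hu.hasFDerivWithinAt hh hSc hSu hfC hx hV0 hVJ hτ, hVenc, N, hN, hVt⟩

end Local

/-! ### Smooth fields on an open domain: the second-order analytic data -/

section Smooth

variable {ι : Type*} [Fintype ι] {Ω : Opens (ι → ℝ)} {f : (ι → ℝ) → ι → ℝ}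
  (hf : ContDiffOn ℝ ∞ f (Ω : Set (ι → ℝ)))

/-- The flow Taylor coefficient maps `Φ_k = (1/k!) L_f^k Id` of a field `C^∞` on an open `Ω` are
`C^∞` on `Ω`. [cite: HairerWannerLubich2002, §III.5.1 eq. (5.8)] -/
theorem contDiffOn_smoothTaylorMap (k : ℕ) :
    ContDiffOn ℝ ∞ (smoothTaylorMap hf k) (Ω : Set (ι → ℝ)) := by
  rw [contDiffOn_pi]
  intro i
  exact (SmoothFun.contDiffOn (flowCoeff hf k i)).congr fun x hx =>
    smoothTaylorMap_apply_of_mem hf k hx i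

/-- On `Ω` the Fréchet derivative of `Φ_k` is the Jacobian `Φ_k' = smoothTaylorFDeriv hf k`
assembled from the gradients of its components. [cite: HairerWannerLubich2002, §III.5.1 eq. (5.4)] -/
theorem fderiv_smoothTaylorMap_of_mem (k : ℕ) {x : ι → ℝ} (hx : x ∈ Ω) :
    fderiv ℝ (smoothTaylorMap hf k) x = smoothTaylorFDeriv hf k x :=
  (hasFDerivAt_smoothTaylorMap hf k hx).fderiv

/-- `x ↦ Φ_k'(x)` is `C^∞` on `Ω`. [cite: HairerWannerLubich2002, §III.5.1 eq. (5.4)] -/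
theorem contDiffOn_fderiv_smoothTaylorMap (k : ℕ) :
    ContDiffOn ℝ ∞ (fderiv ℝ (smoothTaylorMap hf k)) (Ω : Set (ι → ℝ)) :=
  ((contDiffOn_infty_iff_fderiv_of_isOpen Ω.isOpen).1 (contDiffOn_smoothTaylorMap hf k)).2

/-- `x ↦ Φ_k''(x) = D(Φ_k')(x)` is `C^∞` on `Ω`. [cite: HairerWannerLubich2002, §III.5.1 eq. (5.4)] -/
theorem contDiffOn_fderiv_fderiv_smoothTaylorMap (k : ℕ) :
    ContDiffOn ℝ ∞ (fderiv ℝ (fderiv ℝ (smoothTaylorMap hf k))) (Ω : Set (ι → ℝ)) :=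
  ((contDiffOn_infty_iff_fderiv_of_isOpen Ω.isOpen).1 (contDiffOn_fderiv_smoothTaylorMap hf k)).2

/-- `Φ_k'` is differentiable on `Ω` with derivative `Φ_k'' = D(Φ_k')` (hypothesis `hder2` of
`variationalEnclosure_step`). [cite: HairerWannerLubich2002, §III.5.1 eq. (5.4)] -/
theorem hasFDerivAt_fderiv_smoothTaylorMap (k : ℕ) {x : ι → ℝ} (hx : x ∈ Ω) :
    HasFDerivAt (fderiv ℝ (smoothTaylorMap hf k))
      (fderiv ℝ (fderiv ℝ (smoothTaylorMap hf k)) x) x :=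
  (((contDiffOn_fderiv_smoothTaylorMap hf k).differentiableOn (by simp)).differentiableAt
    (Ω.isOpen.mem_nhds hx)).hasFDerivAt

/-- `Φ_k` is differentiable on `Ω` with derivative `fderiv ℝ Φ_k` (hypothesis `hder` of
`variationalEnclosure_step`). [cite: HairerWannerLubich2002, §III.5.1 eq. (5.4)] -/
theorem hasFDerivAt_smoothTaylorMap' (k : ℕ) {x : ι → ℝ} (hx : x ∈ Ω) :
    HasFDerivAt (smoothTaylorMap hf k) (fderiv ℝ (smoothTaylorMap hf k) x) x := by
  rw [fderiv_smoothTaylorMap_of_mem hf k hx]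
  exact hasFDerivAt_smoothTaylorMap hf k hx

/-- `Φ_0' = Id` everywhere (`Φ_0 = id`; hypothesis `hΦ'0` of `variationalEnclosure_step`).
[cite: HairerWannerLubich2002, §III.5.1 eq. (5.8)] [cite: Moore1979, §3.4 eq. (3.14)] -/
theorem fderiv_smoothTaylorMap_zero (x : ι → ℝ) : fderiv ℝ (smoothTaylorMap hf 0) x = 1 := by
  have h0 : smoothTaylorMap hf 0 = id := funext (smoothTaylorMap_zero hf)
  rw [h0, fderiv_id]
  rfl

/-- **The Lie–Taylor recursion for the Jacobians**: `Φ_k'(x) f(x) = (k+1) Φ_{k+1}(x)` on `Ω`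
(hypothesis `hrec` of `variationalEnclosure_step`). [cite: Moore1979, §3.4 eq. (3.15)]
[cite: HairerWannerLubich2002, §III.5.1 eq. (5.6)] -/
theorem fderiv_smoothTaylorMap_apply_field (k : ℕ) {x : ι → ℝ} (hx : x ∈ Ω) :
    fderiv ℝ (smoothTaylorMap hf k) x (f x) = ((k : ℝ) + 1) • smoothTaylorMap hf (k + 1) x := by
  rw [fderiv_smoothTaylorMap_of_mem hf k hx, smoothTaylorFDeriv_apply_field hf k hx]

include hf in
/-- The field itself is differentiable on `Ω` with derivative `Df = fderiv ℝ f` (hypothesis `hf'`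
of `variationalEnclosure_step`). [cite: WalawskaWilczak2016, §1.1 (Df, the variational equation)] -/
theorem hasFDerivAt_field_of_contDiffOn {x : ι → ℝ} (hx : x ∈ Ω) :
    HasFDerivAt f (fderiv ℝ f x) x :=
  (((hf.differentiableOn (by simp)).differentiableAt (Ω.isOpen.mem_nhds hx))).hasFDerivAt

/-- On a compact `S ⊆ Ω` the Jacobians `Φ_j'` and their derivatives `Φ_j''`, `j ≤ K`, are
uniformly bounded (hypotheses `hbd`, `hbd2` of `variationalEnclosure_step`).
[cite: Moore1979, §3.4 eq. (3.17)] [cite: WalawskaWilczak2016, §2.1 (C¹ high-order enclosure)] -/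
theorem exists_bound_fderiv_smoothTaylorMap (K : ℕ) {S : Set (ι → ℝ)} (hS : IsCompact S)
    (hSΩ : S ⊆ Ω) :
    ∃ B : ℝ, (∀ j ≤ K, ∀ x ∈ S, ‖fderiv ℝ (smoothTaylorMap hf j) x‖ ≤ B) ∧
      ∀ j ≤ K, ∀ x ∈ S, ‖fderiv ℝ (fderiv ℝ (smoothTaylorMap hf j)) x‖ ≤ B := by
  have h1 : ∀ j : ℕ, ∃ B : ℝ, ∀ x ∈ S, ‖fderiv ℝ (smoothTaylorMap hf j) x‖ ≤ B := fun j => by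
    obtain ⟨C, hC⟩ := hS.exists_bound_of_continuousOn (E := (ι → ℝ) →L[ℝ] (ι → ℝ))
      ((contDiffOn_fderiv_smoothTaylorMap hf j).continuousOn.mono hSΩ)
    exact ⟨C, fun x hx => hC x hx⟩
  have h2 : ∀ j : ℕ, ∃ B : ℝ, ∀ x ∈ S, ‖fderiv ℝ (fderiv ℝ (smoothTaylorMap hf j)) x‖ ≤ B :=
    fun j => by
    obtain ⟨C, hC⟩ := hS.exists_bound_of_continuousOn
      (E := (ι → ℝ) →L[ℝ] ((ι → ℝ) →L[ℝ] (ι → ℝ)))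
      ((contDiffOn_fderiv_fderiv_smoothTaylorMap hf j).continuousOn.mono hSΩ)
    exact ⟨C, fun x hx => hC x hx⟩
  choose B₁ hB₁ using h1
  choose B₂ hB₂ using h2
  refine ⟨∑ j ∈ Finset.range (K + 1), (|B₁ j| + |B₂ j|), fun j hj x hx => (hB₁ j x hx).trans ?_,
    fun j hj x hx => (hB₂ j x hx).trans ?_⟩
  · exact ((le_abs_self _).trans (le_add_of_nonneg_right (abs_nonneg _))).trans
      (Finset.single_le_sum (f := fun j => |B₁ j| + |B₂ j|) (fun j _ => by positivity)
        (Finset.mem_range.2 (Nat.lt_succ_of_le hj)))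
  · exact ((le_abs_self _).trans (le_add_of_nonneg_left (abs_nonneg _))).trans
      (Finset.single_le_sum (f := fun j => |B₁ j| + |B₂ j|) (fun j _ => by positivity)
        (Finset.mem_range.2 (Nat.lt_succ_of_le hj)))

/-- On a compact convex `S ⊆ Ω` each Jacobian `Φ_k'` is Lipschitz (hypothesis `hlipK'` of
`variationalEnclosure_step`; mean value inequality with the bound on `Φ_k''`).
[cite: Moore1979, §3.4 eq. (3.17)] [cite: WalawskaWilczak2016, §2.1 (C¹ high-order enclosure)] -/
theorem exists_lipschitzOnWith_fderiv_smoothTaylorMap (k : ℕ) {S : Set (ι → ℝ)}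
    (hS : IsCompact S) (hSc : Convex ℝ S) (hSΩ : S ⊆ Ω) :
    ∃ C : ℝ≥0, LipschitzOnWith C (fderiv ℝ (smoothTaylorMap hf k)) S := by
  obtain ⟨B, -, hB⟩ := exists_bound_fderiv_smoothTaylorMap hf k hS hSΩ
  refine ⟨B.toNNReal, hSc.lipschitzOnWith_of_nnnorm_hasFDerivWithin_le
    (fun x hx => (hasFDerivAt_fderiv_smoothTaylorMap hf k (hSΩ hx)).hasFDerivWithinAt)
    fun x hx => ?_⟩
  rw [← NNReal.coe_le_coe, coe_nnnorm, Real.coe_toNNReal']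
  exact (hB k le_rfl x hx).trans (le_max_left _ _)

/-! ### The C¹ high-order enclosure step for smooth fields on an open domain -/

variable [DecidableEq ι]

/-- **`C¹` high-order enclosure step for a field smooth on an open set — no growth hypothesis, all
analytic hypotheses discharged** (Walawska–Wilczak 2016 §2.1 / §2.2 Lemma 2; Zgliczyński 2002).
Let `f ∈ C^∞(Ω; ℝ^ι)` on an open `Ω`, `K ≥ 1`, `S ⊆ Ω` compact and convex, `h ≥ 0`; write
`Φ_j = smoothTaylorMap hf j` and `Φ_j' = smoothTaylorFDeriv hf j` (the Jacobian of `Φ_j` on `Ω`).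
Suppose `Φ_K(S) ⊆ [c, d]`, `Φ_K'(z) ∘ M ∈ [CN, DN]` (entrywise) for `z ∈ S`, `M ∈ [CV, DV]`, and,
for every `x ∈ W` and `t ∈ [0, h]`, the state test `∑_{j<K} t^j Φ_j(x) + t^K [c, d] ⊆ S` and the
`C¹` test `∑_{j<K} t^j Φ_j'(x) + t^K [CN, DN] ⊆ [CV, DV]`.  Then for every `x ∈ W` the
variational system `y' = f(y)`, `V' = Df(y) ∘ V` (`Df = fderiv ℝ f`), `y 0 = x`, `V 0 = Id` has a
solution on `[0, h]`, and EVERY solution pair `(z, J)` satisfies `z t ∈ S`,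
`z t ∈ ∑_{j<K} t^j Φ_j(x) + t^K [c, d]`, `J t ∈ [CV, DV]` and `J t ∈ ∑_{j<K} t^j Φ_j'(x) + t^K [CN, DN]`
for all `t ∈ [0, h]` — `variationalEnclosure_step` with `hΦ0`, `hΦ'0`, `hder`, `hder2`, `hf'`,
`hrec`, `hbd`, `hbd2`, `hlipK`, `hlipK'` AND `hloc` discharged, so that fields with singularities
off `Ω` (quotients, logarithms, roots, real powers: Moore 1979 §3.4 (3.19)) are covered.
[cite: WalawskaWilczak2016, §2.1 (C¹ high-order enclosure) and §2.2 Lemma 2]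
[cite: Moore1979, §3.4 eqs. (3.13)–(3.19)]
[cite: Teschl2012, §2.6 (uniqueness on the common interval, before Theorem 2.13)] -/
theorem variationalEnclosure_step_smoothOn_local {K : ℕ} (hK : 0 < K) {S W : Set (ι → ℝ)}
    {c d : ι → ℝ} {CV DV CN DN : ι → ι → ℝ} {h : ℝ}
    (hSΩ : S ⊆ Ω) (hS : IsCompact S) (hSc : Convex ℝ S) (hcd : c ≤ d)
    (hKS : MapsTo (smoothTaylorMap hf K) S (Icc c d)) (hCDN : CN ≤ DN)
    (hKN : ∀ z ∈ S, ∀ M : (ι → ℝ) →L[ℝ] (ι → ℝ), (fun i j => M (Pi.single j 1) i) ∈ Icc CV DV →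
      (fun i j => (smoothTaylorFDeriv hf K z).comp M (Pi.single j 1) i) ∈ Icc CN DN)
    (hh : 0 ≤ h)
    (hincl : ∀ x ∈ W, ∀ t ∈ Icc 0 h, ∀ v ∈ Icc c d,
      (∑ j ∈ Finset.range K, t ^ j • smoothTaylorMap hf j x) + t ^ K • v ∈ S)
    (hinclV : ∀ x ∈ W, ∀ t ∈ Icc 0 h, ∀ N : (ι → ℝ) →L[ℝ] (ι → ℝ),
      (fun i j => N (Pi.single j 1) i) ∈ Icc CN DN →
      (fun i j => ((∑ k ∈ Finset.range K, t ^ k • smoothTaylorFDeriv hf k x) + t ^ K • N)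
        (Pi.single j 1) i) ∈ Icc CV DV)
    {x : ι → ℝ} (hx : x ∈ W) :
    (∃ y : ℝ → ι → ℝ, ∃ V : ℝ → (ι → ℝ) →L[ℝ] (ι → ℝ), y 0 = x ∧ V 0 = 1 ∧
      (∀ t ∈ Icc 0 h, HasDerivWithinAt y (f (y t)) (Icc 0 h) t) ∧
      ∀ t ∈ Icc 0 h, HasDerivWithinAt V ((fderiv ℝ f (y t)).comp (V t)) (Icc 0 h) t) ∧
    ∀ (z : ℝ → ι → ℝ) (J : ℝ → (ι → ℝ) →L[ℝ] (ι → ℝ)), z 0 = x → J 0 = 1 →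
      (∀ t ∈ Icc 0 h, HasDerivWithinAt z (f (z t)) (Icc 0 h) t) →
      (∀ t ∈ Icc 0 h, HasDerivWithinAt J ((fderiv ℝ f (z t)).comp (J t)) (Icc 0 h) t) →
      ∀ t ∈ Icc 0 h,
        (z t ∈ S ∧ ∃ v ∈ Icc c d,
          z t = (∑ j ∈ Finset.range K, t ^ j • smoothTaylorMap hf j x) + t ^ K • v) ∧
        (fun i j => J t (Pi.single j 1) i) ∈ Icc CV DV ∧
        ∃ N : (ι → ℝ) →L[ℝ] (ι → ℝ), (fun i j => N (Pi.single j 1) i) ∈ Icc CN DN ∧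
          J t = (∑ j ∈ Finset.range K, t ^ j • smoothTaylorFDeriv hf j x) + t ^ K • N := by
  -- every initial point lies in `S ⊆ Ω` (the state test at `t = 0`)
  have hWS : ∀ x ∈ W, x ∈ S := fun x hx => by
    have h0 := hincl x hx 0 ⟨le_rfl, hh⟩ c ⟨le_rfl, hcd⟩
    rwa [taylorSum_at_zero (smoothTaylorMap_zero hf) hK] at h0
  -- the Jacobian Taylor sums, written with `fderiv` or with `smoothTaylorFDeriv`, agree on `Ω`
  have hsum : ∀ x ∈ W, ∀ (t : ℝ),
      (∑ k ∈ Finset.range K, t ^ k • fderiv ℝ (smoothTaylorMap hf k) x) =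
        ∑ k ∈ Finset.range K, t ^ k • smoothTaylorFDeriv hf k x := fun x hx t =>
    Finset.sum_congr rfl fun k _ => by rw [fderiv_smoothTaylorMap_of_mem hf k (hSΩ (hWS x hx))]
  -- the analytic data on the compact convex box
  obtain ⟨B, hB₁, hB₂⟩ := exists_bound_fderiv_smoothTaylorMap hf K hS hSΩ
  obtain ⟨L, hL⟩ := exists_lipschitzOnWith_smoothTaylorMap hf K hS hSc hSΩ
  obtain ⟨L', hL'⟩ := exists_lipschitzOnWith_fderiv_smoothTaylorMap hf K hS hSc hSΩ
  have hKN' : ∀ z ∈ S, ∀ M : (ι → ℝ) →L[ℝ] (ι → ℝ),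
      (fun i j => M (Pi.single j 1) i) ∈ Icc CV DV →
      (fun i j => (fderiv ℝ (smoothTaylorMap hf K) z).comp M (Pi.single j 1) i) ∈ Icc CN DN :=
    fun z hz M hM => by
      rw [fderiv_smoothTaylorMap_of_mem hf K (hSΩ hz)]
      exact hKN z hz M hM
  have hinclV' : ∀ x ∈ W, ∀ t ∈ Icc 0 h, ∀ N : (ι → ℝ) →L[ℝ] (ι → ℝ),
      (fun i j => N (Pi.single j 1) i) ∈ Icc CN DN →
      (fun i j => ((∑ k ∈ Finset.range K, t ^ k • fderiv ℝ (smoothTaylorMap hf k) x) + t ^ K • N)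
        (Pi.single j 1) i) ∈ Icc CV DV := fun x hx t ht N hN => by
    rw [hsum x hx t]
    exact hinclV x hx t ht N hN
  obtain ⟨hex, huniq⟩ := variationalEnclosure_step_local (f := f) (f' := fderiv ℝ f)
    (Φ := smoothTaylorMap hf) (Φ' := fun j x => fderiv ℝ (smoothTaylorMap hf j) x)
    (Φ'' := fun j x => fderiv ℝ (fderiv ℝ (smoothTaylorMap hf j)) x) hK Ω.isOpen hSΩ
    (smoothTaylorMap_zero hf) (fderiv_smoothTaylorMap_zero hf)
    (fun j _ x hx => hasFDerivAt_smoothTaylorMap' hf j hx)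
    (fun j _ x hx => hasFDerivAt_fderiv_smoothTaylorMap hf j hx)
    (fun x hx => hasFDerivAt_field_of_contDiffOn hf hx)
    (fun j _ x hx => fderiv_smoothTaylorMap_apply_field hf j hx) hB₁
    (fun j hj x hx => hB₂ j hj.le x hx) hL hL' hcd hKS hCDN hKN' hh
    (fun x hx => exists_lipschitzOnWith_nhds_of_contDiffOn Ω.isOpen hf (hSΩ hx))
    hincl hinclV' hx
  refine ⟨hex, fun z J hz0 hJ0 hz hJ t ht => ?_⟩
  obtain ⟨hzenc, hJenc, N, hN, hJt⟩ := huniq z J hz0 hJ0 hz hJ t ht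
  refine ⟨hzenc, hJenc, N, hN, ?_⟩
  rw [hJt, hsum x hx t]

/-- **The `C¹` enclosure bounds the derivative of the flow — smooth field on an open domain**
(Zgliczyński 2002; Walawska–Wilczak 2016 §1.1: `ψ(t, x, Id) = D_xφ(t, x)`, §2.2 Lemma 2).  Under
the hypotheses of `variationalEnclosure_step_smoothOn_local` (with `S` a set of unique
differentiability, e.g. a box with non-empty interior), for ANY family `u` of solutions of
`y' = f(y)` on `[0, h]` from the points of `W` staying in `S`, every `x ∈ W` and `τ ∈ [0, h]`: the
flow map `x' ↦ u x' τ` has a derivative `J` at `x` within `W` with `J ∈ [CV, DV]` and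
`J = ∑_{j<K} τ^j • Φ_j'(x) + τ^K • N`, `N ∈ [CN, DN]` (entrywise) — the interval matrix
`∑_{j<K} [0,h]^j Df^[j](W) + [0,h]^K Df^[K](S) Ṽ` of a `C¹`-Lohner step contains `∂φ(τ, x)/∂x`,
with no hypothesis on `f` off `Ω`.
[cite: WalawskaWilczak2016, §1.1 (ψ = D_xφ·V) and §2.2 Lemma 2]
[cite: Teschl2012, §2.6 (uniqueness on the common interval, before Theorem 2.13)] -/
theorem hasFDerivWithinAt_flow_of_variationalEnclosure_smoothOn_local {K : ℕ} (hK : 0 < K)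
    {S W : Set (ι → ℝ)} {c d : ι → ℝ} {CV DV CN DN : ι → ι → ℝ} {h : ℝ}
    (hSΩ : S ⊆ Ω) (hS : IsCompact S) (hSc : Convex ℝ S) (hSu : UniqueDiffOn ℝ S) (hcd : c ≤ d)
    (hKS : MapsTo (smoothTaylorMap hf K) S (Icc c d)) (hCDN : CN ≤ DN)
    (hKN : ∀ z ∈ S, ∀ M : (ι → ℝ) →L[ℝ] (ι → ℝ), (fun i j => M (Pi.single j 1) i) ∈ Icc CV DV →
      (fun i j => (smoothTaylorFDeriv hf K z).comp M (Pi.single j 1) i) ∈ Icc CN DN)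
    (hh : 0 ≤ h)
    (hincl : ∀ x ∈ W, ∀ t ∈ Icc 0 h, ∀ v ∈ Icc c d,
      (∑ j ∈ Finset.range K, t ^ j • smoothTaylorMap hf j x) + t ^ K • v ∈ S)
    (hinclV : ∀ x ∈ W, ∀ t ∈ Icc 0 h, ∀ N : (ι → ℝ) →L[ℝ] (ι → ℝ),
      (fun i j => N (Pi.single j 1) i) ∈ Icc CN DN →
      (fun i j => ((∑ k ∈ Finset.range K, t ^ k • smoothTaylorFDeriv hf k x) + t ^ K • N)
        (Pi.single j 1) i) ∈ Icc CV DV)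
    {u : (ι → ℝ) → ℝ → ι → ℝ} (hu : IsSolutionFamily f S W h u) {x : ι → ℝ} (hx : x ∈ W)
    {τ : ℝ} (hτ : τ ∈ Icc 0 h) :
    ∃ J : (ι → ℝ) →L[ℝ] (ι → ℝ), HasFDerivWithinAt (fun x' => u x' τ) J W x ∧
      (fun i j => J (Pi.single j 1) i) ∈ Icc CV DV ∧
      ∃ N : (ι → ℝ) →L[ℝ] (ι → ℝ), (fun i j => N (Pi.single j 1) i) ∈ Icc CN DN ∧
        J = (∑ j ∈ Finset.range K, τ ^ j • smoothTaylorFDeriv hf j x) + τ ^ K • N := by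
  have hWS : ∀ x ∈ W, x ∈ S := fun x hx => by
    have h0 := hincl x hx 0 ⟨le_rfl, hh⟩ c ⟨le_rfl, hcd⟩
    rwa [taylorSum_at_zero (smoothTaylorMap_zero hf) hK] at h0
  have hsum : ∀ x ∈ W, ∀ (t : ℝ),
      (∑ k ∈ Finset.range K, t ^ k • fderiv ℝ (smoothTaylorMap hf k) x) =
        ∑ k ∈ Finset.range K, t ^ k • smoothTaylorFDeriv hf k x := fun x hx t =>
    Finset.sum_congr rfl fun k _ => by rw [fderiv_smoothTaylorMap_of_mem hf k (hSΩ (hWS x hx))]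
  obtain ⟨B, hB₁, hB₂⟩ := exists_bound_fderiv_smoothTaylorMap hf K hS hSΩ
  obtain ⟨L, hL⟩ := exists_lipschitzOnWith_smoothTaylorMap hf K hS hSc hSΩ
  obtain ⟨L', hL'⟩ := exists_lipschitzOnWith_fderiv_smoothTaylorMap hf K hS hSc hSΩ
  have hKN' : ∀ z ∈ S, ∀ M : (ι → ℝ) →L[ℝ] (ι → ℝ),
      (fun i j => M (Pi.single j 1) i) ∈ Icc CV DV →
      (fun i j => (fderiv ℝ (smoothTaylorMap hf K) z).comp M (Pi.single j 1) i) ∈ Icc CN DN :=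
    fun z hz M hM => by
      rw [fderiv_smoothTaylorMap_of_mem hf K (hSΩ hz)]
      exact hKN z hz M hM
  have hinclV' : ∀ x ∈ W, ∀ t ∈ Icc 0 h, ∀ N : (ι → ℝ) →L[ℝ] (ι → ℝ),
      (fun i j => N (Pi.single j 1) i) ∈ Icc CN DN →
      (fun i j => ((∑ k ∈ Finset.range K, t ^ k • fderiv ℝ (smoothTaylorMap hf k) x) + t ^ K • N)
        (Pi.single j 1) i) ∈ Icc CV DV := fun x hx t ht N hN => by
    rw [hsum x hx t]
    exact hinclV x hx t ht N hN
  have hfC : ContDiffOn ℝ 1 f S := (hf.of_le (by exact_mod_cast le_top)).mono hSΩ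
  obtain ⟨J, hJ, hJenc, N, hN, hJt⟩ := hasFDerivWithinAt_flow_of_variationalEnclosure_local
    (f := f) (f' := fderiv ℝ f) (Φ := smoothTaylorMap hf)
    (Φ' := fun j x => fderiv ℝ (smoothTaylorMap hf j) x)
    (Φ'' := fun j x => fderiv ℝ (fderiv ℝ (smoothTaylorMap hf j)) x) hK Ω.isOpen hSΩ
    (smoothTaylorMap_zero hf) (fderiv_smoothTaylorMap_zero hf)
    (fun j _ x hx => hasFDerivAt_smoothTaylorMap' hf j hx)
    (fun j _ x hx => hasFDerivAt_fderiv_smoothTaylorMap hf j hx)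
    (fun x hx => hasFDerivAt_field_of_contDiffOn hf hx)
    (fun j _ x hx => fderiv_smoothTaylorMap_apply_field hf j hx) hB₁
    (fun j hj x hx => hB₂ j hj.le x hx) hL hL' hcd hKS hCDN hKN' hh
    (fun x hx => exists_lipschitzOnWith_nhds_of_contDiffOn Ω.isOpen hf (hSΩ hx))
    hincl hinclV' hSc hSu hfC hu hx hτ
  refine ⟨J, hJ, hJenc, N, hN, ?_⟩
  rw [hJt, hsum x hx τ]

end Smooth

end Literature.Analysis.ODE

end
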